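import Literature.NumberTheory.Automorphic.JacquetLineExponents
import HarnessLib

/-!
# The two cases of [Casselman1995, §7.1] for a length-two `ρ` with `dim r(ρ) = 2`: which side of `0 → r(σ) → r(ρ) → r(τ) → 0` carries the line

Generic representation theory (theorems only), continuing ★ `JacquetLineExponents`.  Along `G`-maps `σ → ρ → τ` with injective ∕ exact ∕ surjective
Jacquet maps (★ `Representation.jacquet_exact`), if `r(ρ)` is two-dimensional with a stable line `ℓ` (character `θ₁`) and quotient character `θ₂`, and BOTH
`r(σ) ≠ 0` and `r(τ) ≠ 0`, then `dim r(σ) = dim r(τ) = 1` and EITHER `r(σ)` is the line `θ₁` and `r(τ)` the line `θ₂` (the image of `r(σ)` is `ℓ`), OR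
`r(σ)` is the line `θ₂` and `r(τ)` the line `θ₁` (the image of `r(σ)` meets `ℓ` trivially).  No square-integrability input is used (contrast ★
`finrank_eq_one_and_normalizedJacquet_eq_of_line`, which decides the case from «`θ₁` is not an exponent of `σ`»).  Written for the T3 «KeysCaseTwo»
pay-down of cell pub/hodgecm-mathlib F0∕P3 (stub S2), automorphic-free.

## References
[Casselman1995] W. Casselman, *Introduction to the theory of admissible representations of p-adic reductive groups* (draft 1995), L. 7.1.1 (a),
Cor. 7.1.2, Cor. 6.3.9 (b), Prop. 6.4.1, Prop. 3.2.3 · [BernsteinZelevinsky1977] §2.3, Cor. 2.13 (c).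
-/

set_option autoImplicit false

noncomputable section

namespace Representation

open Literature.NumberTheory.Automorphic

variable {G : Type*} [Group G] [TopologicalSpace G] [IsTopologicalGroup G]
  (t : ParabolicTriple G) [LocallyCompactSpace t.P]
  {V₁ V₂ V₃ : Type*} [AddCommGroup V₁] [Module ℂ V₁] [AddCommGroup V₂] [Module ℂ V₂] [AddCommGroup V₃] [Module ℂ V₃]
  {ρ₁ : Representation ℂ G V₁} {ρ₂ : Representation ℂ G V₂} {ρ₃ : Representation ℂ G V₃}

/-- **The two cases.**  Output: `r(σ)`, `r(τ)` finite-dimensional of dimension `1`, and the dichotomy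
`(M acts on r(σ) by θ₁ ∧ on r(τ) by θ₂) ∨ (M acts on r(σ) by θ₂ ∧ on r(τ) by θ₁)`.
[cite: Casselman1995, L. 7.1.1 (a), Cor. 7.1.2, Prop. 6.4.1, Prop. 3.2.3] [cite: BernsteinZelevinsky1977, Cor. 2.13 (c)] -/
theorem normalizedJacquet_sub_quot_cases_of_line {θ₁ θ₂ : ↥t.M →* ℂˣ} (f : ρ₁.IntertwiningMap ρ₂) (g : ρ₂.IntertwiningMap ρ₃)
    (hf : Function.Injective (jacquetMap t f)) (hfg : Function.Exact (jacquetMap t f) (jacquetMap t g))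
    (hg : Function.Surjective (jacquetMap t g))
    [FiniteDimensional ℂ (t.restrict ρ₂).Coinvariants] (h2 : Module.finrank ℂ (t.restrict ρ₂).Coinvariants = 2)
    (ℓ : Submodule ℂ (t.restrict ρ₂).Coinvariants) (hℓ1 : Module.finrank ℂ ↥ℓ = 1)
    (hℓ : ∀ (m : ↥t.M), ∀ x ∈ ℓ, ρ₂.normalizedJacquet t m x = ((θ₁ m : ℂˣ) : ℂ) • x)
    (hq : ∀ (m : ↥t.M) (x : (t.restrict ρ₂).Coinvariants), ρ₂.normalizedJacquet t m x - ((θ₂ m : ℂˣ) : ℂ) • x ∈ ℓ)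
    [Nontrivial (t.restrict ρ₁).Coinvariants] [Nontrivial (t.restrict ρ₃).Coinvariants] :
    FiniteDimensional ℂ (t.restrict ρ₁).Coinvariants ∧ FiniteDimensional ℂ (t.restrict ρ₃).Coinvariants ∧
      Module.finrank ℂ (t.restrict ρ₁).Coinvariants = 1 ∧ Module.finrank ℂ (t.restrict ρ₃).Coinvariants = 1 ∧
      (((∀ (m : ↥t.M) (x : (t.restrict ρ₁).Coinvariants), ρ₁.normalizedJacquet t m x = ((θ₁ m : ℂˣ) : ℂ) • x) ∧
          ∀ (m : ↥t.M) (z : (t.restrict ρ₃).Coinvariants), ρ₃.normalizedJacquet t m z = ((θ₂ m : ℂˣ) : ℂ) • z) ∨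
        ((∀ (m : ↥t.M) (x : (t.restrict ρ₁).Coinvariants), ρ₁.normalizedJacquet t m x = ((θ₂ m : ℂˣ) : ℂ) • x) ∧
          ∀ (m : ↥t.M) (z : (t.restrict ρ₃).Coinvariants), ρ₃.normalizedJacquet t m z = ((θ₁ m : ℂˣ) : ℂ) • z)) := by
  set F : (t.restrict ρ₁).Coinvariants →ₗ[ℂ] (t.restrict ρ₂).Coinvariants := (jacquetMap t f).toLinearMap with hFdef
  set Q : (t.restrict ρ₂).Coinvariants →ₗ[ℂ] (t.restrict ρ₃).Coinvariants := (jacquetMap t g).toLinearMap with hQdef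
  have hF : ∀ x, F x = jacquetMap t f x := fun x => rfl
  have hQ : ∀ x, Q x = jacquetMap t g x := fun x => rfl
  have hFi : Function.Injective F := hf
  have hQs : Function.Surjective Q := hg
  have hex : LinearMap.ker Q = LinearMap.range F := LinearMap.exact_iff.1 hfg
  haveI hfd1 : FiniteDimensional ℂ (t.restrict ρ₁).Coinvariants := Module.Finite.of_injective F hFi
  haveI hfd3 : FiniteDimensional ℂ (t.restrict ρ₃).Coinvariants := Module.Finite.of_surjective Q hQs
  -- dimensions
  have hrn := LinearMap.finrank_range_add_finrank_ker Q
  rw [LinearMap.range_eq_top.2 hQs, finrank_top, hex, LinearMap.finrank_range_of_inj hFi, h2] at hrn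
  have hpos1 : 0 < Module.finrank ℂ (t.restrict ρ₁).Coinvariants := Module.finrank_pos
  have hpos3 : 0 < Module.finrank ℂ (t.restrict ρ₃).Coinvariants := Module.finrank_pos
  have h1 : Module.finrank ℂ (t.restrict ρ₁).Coinvariants = 1 := by omega
  have h3 : Module.finrank ℂ (t.restrict ρ₃).Coinvariants = 1 := by omega
  refine ⟨hfd1, hfd3, h1, h3, ?_⟩
  -- intertwining of `F`, `Q` with the normalised actions
  have hFm : ∀ (m : ↥t.M) (x : (t.restrict ρ₁).Coinvariants), F (ρ₁.normalizedJacquet t m x) = ρ₂.normalizedJacquet t m (F x) :=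
    fun m x => jacquetMap_normalizedJacquet t f m x
  have hQm : ∀ (m : ↥t.M) (y : (t.restrict ρ₂).Coinvariants), Q (ρ₂.normalizedJacquet t m y) = ρ₃.normalizedJacquet t m (Q y) :=
    fun m y => jacquetMap_normalizedJacquet t g m y
  have hR1 : Module.finrank ℂ ↥(LinearMap.range F) = 1 := (LinearMap.finrank_range_of_inj hFi).trans h1
  by_cases hR : LinearMap.range F = ℓ
  · -- CASE `r(f)(r(σ)) = ℓ`: `σ` carries `θ₁`, `τ` carries `θ₂`
    left
    refine ⟨fun m x => hFi ?_, fun m z => ?_⟩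
    · rw [hFm, map_smul]
      exact hℓ m _ (hR ▸ LinearMap.mem_range_self F x)
    · obtain ⟨y, rfl⟩ := hQs z
      have hl : Q (ρ₂.normalizedJacquet t m y - ((θ₂ m : ℂˣ) : ℂ) • y) = 0 :=
        LinearMap.mem_ker.1 (hex ▸ hR ▸ hq m y)
      rw [map_sub, map_smul, sub_eq_zero] at hl
      rw [← hQm, hl]
  · -- CASE `r(f)(r(σ)) ∩ ℓ = 0`: `σ` carries `θ₂`, `τ` carries `θ₁`
    right
    have hRℓ : LinearMap.range F ⊓ ℓ = ⊥ := by
      by_contra hne0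
      have hpos : 0 < Module.finrank ℂ ↥(LinearMap.range F ⊓ ℓ) :=
        Nat.pos_of_ne_zero fun h0 => hne0 (Submodule.finrank_eq_zero.1 h0)
      have hR' : LinearMap.range F ⊓ ℓ = LinearMap.range F :=
        Submodule.eq_of_le_of_finrank_le inf_le_left (by rw [hR1]; exact hpos)
      have hℓ' : LinearMap.range F ⊓ ℓ = ℓ :=
        Submodule.eq_of_le_of_finrank_le inf_le_right (by rw [hℓ1]; exact hpos)
      exact hR (hR'.symm.trans hℓ')
    have hσ : ∀ (m : ↥t.M) (x : (t.restrict ρ₁).Coinvariants), ρ₁.normalizedJacquet t m x = ((θ₂ m : ℂˣ) : ℂ) • x := by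
      intro m x
      have hmem : F (ρ₁.normalizedJacquet t m x - ((θ₂ m : ℂˣ) : ℂ) • x) ∈ LinearMap.range F ⊓ ℓ := by
        refine ⟨LinearMap.mem_range_self F _, ?_⟩
        rw [map_sub, map_smul, hFm]
        exact hq m _
      rw [hRℓ, Submodule.mem_bot] at hmem
      exact sub_eq_zero.1 (hFi (by rw [hmem, map_zero]))
    refine ⟨hσ, ?_⟩
    have hℓ0 : ℓ ≠ ⊥ := fun h0 => by rw [h0, finrank_bot] at hℓ1; exact zero_ne_one hℓ1
    obtain ⟨y₀, hy₀, hy₀0⟩ := Submodule.exists_mem_ne_zero_of_ne_bot hℓ0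
    have hz₀ : Q y₀ ≠ 0 := by
      intro h0
      have hy : y₀ ∈ LinearMap.range F ⊓ ℓ := ⟨hex ▸ LinearMap.mem_ker.2 h0, hy₀⟩
      rw [hRℓ, Submodule.mem_bot] at hy
      exact hy₀0 hy
    have hz₀m : ∀ m : ↥t.M, ρ₃.normalizedJacquet t m (Q y₀) = ((θ₁ m : ℂˣ) : ℂ) • Q y₀ := fun m => by
      rw [← hQm, hℓ m _ hy₀, map_smul]
    have hgen := (finrank_eq_one_iff_of_nonzero' (Q y₀) hz₀).1 h3
    intro m z
    obtain ⟨c, rfl⟩ := hgen z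
    rw [map_smul, hz₀m m, smul_comm]

end Representation

end
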